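import Mathlib

/-!
# Phase-torus law — «control» lens g5, LINE for idea-crit-6 (2026-08-29)

Crux of record: `Summit.HodgeConjecture.HodgeConjecture.Theses.EightfoldBlochSeeds.BlochSeedDiscOne`
(= `HasHyperbolicBlochSeed 4 1`, item stmt-HodgeConjecture-18881; skeleton `Lines/birth.lean`, STUB R
`stub_rung_pad4_seedAt`, named technique = PAD-4 two-level ⊕-block design with a TWO-TERM line-bundle
presentation `0 → 𝓔 → ⊕ L_i → ⊕ M_j → 0` / `⊕ M_j → ⊕ L_i → 𝓔 → 0`).
Nothing in this file proves HC, HC_AV, HC_CM, H2 or item 18881.  v3 = v2.2 + PARTS C and A·B·D TYPED (spec signatures by control g5,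
bodies by s4-prove-1 g32, 2026-08-29): the file is `sorry`-free; `stub_coveringLemma` is closed by `coveringLemma_holds` and the
law itself by `phaseTorusLaw_holds : PhaseTorusLaw` (kernel, axioms standard) — a finite harmonic-analysis theorem on `(μ₄)⁴`;
the tower-side dictionary (M)(T) is typed separately (`LinePhaseTorus.lean`).
TREE FORM (gate rule «files with proofs ≤ 400 lines»): TWO files — this one = the statements (`PT`, `chi`, `KAdm`, `moment`,
`PhaseTorusLaw`, `NonOpp`, `CoveringLemma`), the covering lemma (C) and PART C (characters of `(ℤ/4)⁴`); the sequel
`Summits/Ventures/HSemireg/PhaseTorusLawProof.lean` = PARTS A·B·D ending in `phaseTorusLaw_holds : PhaseTorusLaw`.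
Bytes of record of the one-file form: crux workfile `Cruxes/BlochSeedDiscOne/PhaseTorusLaw.lean` v3 52fb647b3775bccb.

## The law (pen ×2: this seat + idea-crit-6 g10 bus l.35820, director WORD «PHASE-TORUS ×2 (pen)» R19.132 l.35827; numerics `ctl/moments.py` 4f5d37053c3e568a, `ctl/phasetorus_check.py` ac20110cde10246e; v2 = `stub_coveringLemma` closed in the kernel by s4-prove-1 g32, bus l.35841)

Let `n ≥ 2` (the LINE height, 14 or 16 in the census) and let `ν = m_N − m_P` be an INTEGER two-level letter
design all of whose letters `(a_f, β_f)`, `β_f = c_f·u_f`, `u_f ∈ μ₄`, lie on the line `a_f + c_f = n`.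
Write `V(x) = c₀c₁c₂c₃`, `U(x) = u₀u₁u₂u₃` (FC cells), `μ(ν) = Σ_x ν(x) β₀β₁β₂β₃`.

* (M)  (H1)-clean on the line ⟺ `e^{-nH}·ch(ν) = Σ_x ν(x) Π_f (1 − c_f I_f + β_f e_f + β̄_f ē_f)
        = γ + ρ·nH + μ·e₀e₁e₂e₃ + μ̄·ē₀ē₁ē₂ē₃`; equivalently every mixed moment
        `Σ_x ν(x) Π_{f∈S} g_f(x)` with `|S| ≥ 2`, `g_f ∈ {c_f, β_f, β̄_f}` VANISHES except `Π β_f = μ`, `Π β̄_f = μ̄`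
        (checked digit-for-digit on six bc5 designs at n = 14, 16, incl. 1db9cf28ed5a048e and f24af79f04ae532c).
* (T)  a P-saturating UP-Hall flow `π` (live pair ⟺ per factor the N-letter is the P-letter slid toward the apex
        along its own ray) with integer residual `r = m_N − inflow ≥ 0`, `Σ r = γ = rank`, gives
        `Σ_x ν(x)V(x)χ(u(x)) = Σ_y W(y)χ(u(y))` for every character `χ` of `(μ₄)⁴`, where
        `W(y) = r(y)V(y) − Σ_{x'} π(y,x')(V(y) − V(x')) ≤ 0` unless `r(y) > 0` (≤ γ cells).
* (P)  PHASE-TORUS LAW below with `A = u({y : r(y) > 0})`, `|A| ≤ γ ≤ 4`, `ω = u_* W` ⟹ `μ = 0`.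
* DOWN (kernel) orientation: `W ≥ 0` and `Σ W = Σ ν V = 0` ⟹ `W = 0` ⟹ `μ = 0` for EVERY rank.

CONSEQUENCE (h-uniform C3): no two-term line-bundle presentation (either orientation, any maps — rank ≤ term
rank, König–Egerváry — any support, any LINE height n) of a bundle of rank ≤ 4 has Weil charge μ ≠ 0.
-/

namespace Summit.Ventures.HSemireg.PhaseTorus

open Finset BigOperators

/-- The phase torus `(μ₄)⁴`, written additively: `t_f = i^{τ_f}`. -/
abbrev PT : Type := Fin 4 → ZMod 4

/-- The character `χ_k(τ) = i^{Σ_f k_f τ_f}`. -/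
noncomputable def chi (k τ : PT) : ℂ := Complex.I ^ (∑ f, k f * τ f).val

/-- Admissible («clean») frequencies `K″`: every entry in `{0, ±1}` and `k ≠ ±(1,1,1,1)`.
These are exactly the (H1) rows seen by the top word after the transport identity (T). -/
def KAdm (k : PT) : Prop := (∀ f, k f ≠ 2) ∧ k ≠ (fun _ => 1) ∧ k ≠ (fun _ => 3)

/-- The `k`-th moment of a real signed measure `ω` on the phase torus. -/
noncomputable def moment (ω : PT → ℝ) (k : PT) : ℂ := ∑ τ, (ω τ : ℂ) * chi k τ

/-- **Phase-torus law** (first lemma of the LINE; finite harmonic analysis on `(μ₄)⁴`):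
a real signed measure whose clean moments vanish and which is non-positive outside at most four points
has vanishing top holomorphic moment.  In the dictionary of the module docstring `moment ω (1,1,1,1) = μ`. -/
def PhaseTorusLaw : Prop :=
  ∀ (ω : PT → ℝ) (A : Finset PT), A.card ≤ 4 → (∀ τ, τ ∉ A → ω τ ≤ 0) →
    (∀ k, KAdm k → moment ω k = 0) → moment ω (fun _ => 1) = 0

/-- Two phases `i^x, i^y` are NOT opposite. A set of pairwise non-opposite values of `μ₄` has ≤ 2 elements
and is a point or an adjacent pair `{s, i·s}` = the zero set of a non-negative `φ ∈ span_ℝ{1, t, t̄}`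
(`1 − Re(s̄t)`, resp. `1 + Re((−1+i)s̄t)`). -/
def NonOpp (x y : ZMod 4) : Prop := y ≠ x + 2

/-- **Covering lemma** («opposite» is a perfect matching of `μ₄`, so among any three values two are
non-opposite — `nonOpp_of_three`; erratum of memo v1 §2 (C) fixed per idea-crit-6 ×2, bus l.35820; exhaustive
numeric check on 91 390 four-sets, `phasetorus_check.py`; SHARP RANGE: the box form holds for every `|A| ≤ 7`
by double counting — memo v1.1 §9 — and fails first at the even-weight real 8-set `E8`):
at most four points of `(μ₄)⁴` can be assigned to three of the four coordinates so that points sharing a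
coordinate carry non-opposite values there; the fourth coordinate stays FREE (it carries the adjustable phase
of the test function `F = Π_f φ_f(t_f) ≥ 0`, `F|_A = 0`, `supp F̂ ⊆ {0,±1}⁴`, whose pairing with `ω` is
`2·Re(a·μ)` with `a ≠ 0` of arbitrary argument — whence `μ = 0`). -/
def CoveringLemma : Prop :=
  ∀ A : Finset PT, A.card ≤ 4 →
    ∃ f₀ : Fin 4, ∃ g : PT → Fin 4, (∀ a ∈ A, g a ≠ f₀) ∧
      ∀ a ∈ A, ∀ b ∈ A, g a = g b → NonOpp (a (g a)) (b (g a))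

/-- `NonOpp` is reflexive: `x ≠ x + 2` in `ZMod 4`. -/
theorem nonOpp_refl (x : ZMod 4) : NonOpp x x := by
  unfold NonOpp; revert x; decide

/-- `NonOpp` is symmetric (`−2 = 2` in `ZMod 4`). -/
theorem nonOpp_symm {x y : ZMod 4} (h : NonOpp x y) : NonOpp y x := by
  unfold NonOpp at h ⊢; revert x y; decide

/-- «Opposite» is a perfect matching of `μ₄`, so among any three values two are non-opposite
(equal or adjacent): the pigeonhole step of the pen proof. -/
theorem nonOpp_of_three (x y z : ZMod 4) : NonOpp x y ∨ NonOpp x z ∨ NonOpp y z := by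
  unfold NonOpp; revert x y z; decide

/-- If `g` is injective on `A`, the same-coordinate condition holds trivially (only `a = b` occurs). -/
theorem cover_of_injOn {A : Finset PT} {g : PT → Fin 4} (hg : Set.InjOn g A) :
    ∀ a ∈ A, ∀ b ∈ A, g a = g b → NonOpp (a (g a)) (b (g a)) := by
  intro a ha b hb h
  obtain rfl := hg ha hb h
  exact nonOpp_refl _

/-- **The covering lemma holds** (pen proof `PHASE-TORUS-LAW-g5.md` §2 (C), kernel-checked): for `|A| ≤ 3` host
the points on three distinct coordinates; for `|A| = 4` host the non-opposite pair among the first three points'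
values at coordinate `0` on coordinate `0`, the remaining two points on coordinates `1`, `2`; coordinate `3` free. -/
theorem coveringLemma_holds : CoveringLemma := by
  intro A hA
  have hnd : A.toList.Nodup := A.nodup_toList
  have hlen : A.toList.length ≤ 4 := by rw [Finset.length_toList]; exact hA
  have hmem : ∀ p, p ∈ A ↔ p ∈ A.toList := fun p => Finset.mem_toList.symm
  generalize A.toList = l at hnd hlen hmem
  rcases l with _ | ⟨a, _ | ⟨b, _ | ⟨c, _ | ⟨d, _ | ⟨e, l⟩⟩⟩⟩⟩
  · -- A = ∅
    refine ⟨0, fun _ => 1, fun p hp => ?_, fun p hp => ?_⟩ <;> simp [hmem] at hp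
  · -- A = {a}
    refine ⟨3, fun _ => 0, fun _ _ => show (0 : Fin 4) ≠ 3 by decide, fun p hp q hq _ => ?_⟩
    simp only [hmem, List.mem_cons, List.not_mem_nil, or_false] at hp hq
    subst hp; subst hq; exact nonOpp_refl _
  · -- A = {a, b}
    simp only [List.nodup_cons, List.mem_cons, List.not_mem_nil, or_false] at hnd
    obtain ⟨hab, -⟩ := hnd
    refine ⟨3, fun p => if p = a then 0 else 1, fun p _ => by dsimp only; split_ifs <;> decide, ?_⟩
    refine cover_of_injOn fun p hp q hq h => ?_
    simp only [Finset.mem_coe, hmem, List.mem_cons, List.not_mem_nil, or_false] at hp hq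
    rcases hp with rfl | rfl <;> rcases hq with rfl | rfl <;> simp_all [eq_comm]
  · -- A = {a, b, c}
    simp only [List.nodup_cons, List.mem_cons, List.not_mem_nil, or_false, not_or] at hnd
    obtain ⟨⟨hab, hac⟩, hbc, -⟩ := hnd
    refine ⟨3, fun p => if p = a then 0 else if p = b then 1 else 2,
      fun p _ => by dsimp only; split_ifs <;> decide, ?_⟩
    refine cover_of_injOn fun p hp q hq h => ?_
    simp only [Finset.mem_coe, hmem, List.mem_cons, List.not_mem_nil, or_false] at hp hq
    rcases hp with rfl | rfl | rfl <;> rcases hq with rfl | rfl | rfl <;> simp_all [eq_comm]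
  · -- A = {a, b, c, d}
    simp only [List.nodup_cons, List.mem_cons, List.not_mem_nil, or_false, not_or] at hnd
    obtain ⟨⟨hab, hac, had⟩, ⟨hbc, hbd⟩, hcd, -⟩ := hnd
    have hba := Ne.symm hab; have hca := Ne.symm hac; have hda := Ne.symm had
    have hcb := Ne.symm hbc; have hdb := Ne.symm hbd; have hdc := Ne.symm hcd
    have hmem' : ∀ p, p ∈ A ↔ p = a ∨ p = b ∨ p = c ∨ p = d := fun p => by
      rw [hmem]; simp only [List.mem_cons, List.not_mem_nil, or_false]
    -- the pigeonhole pair among the values at coordinate 0 of a, b, c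
    rcases nonOpp_of_three (a 0) (b 0) (c 0) with h | h | h
    · -- host a, b on 0; c on 1; d on 2
      refine ⟨3, fun p => if p = c then 1 else if p = d then 2 else 0,
        fun p _ => by dsimp only; split_ifs <;> decide, fun p hp q hq => ?_⟩
      rw [hmem'] at hp hq
      rcases hp with rfl | rfl | rfl | rfl <;> rcases hq with rfl | rfl | rfl | rfl <;>
        simp [hac, had, hbc, hbd, hdc, nonOpp_refl, h, nonOpp_symm h]
    · -- host a, c on 0; b on 1; d on 2
      refine ⟨3, fun p => if p = b then 1 else if p = d then 2 else 0,
        fun p _ => by dsimp only; split_ifs <;> decide, fun p hp q hq => ?_⟩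
      rw [hmem'] at hp hq
      rcases hp with rfl | rfl | rfl | rfl <;> rcases hq with rfl | rfl | rfl | rfl <;>
        simp [hab, had, hcd, hcb, hdb, nonOpp_refl, h, nonOpp_symm h]
    · -- host b, c on 0; a on 1; d on 2
      refine ⟨3, fun p => if p = a then 1 else if p = d then 2 else 0,
        fun p _ => by dsimp only; split_ifs <;> decide, fun p hp q hq => ?_⟩
      rw [hmem'] at hp hq
      rcases hp with rfl | rfl | rfl | rfl <;> rcases hq with rfl | rfl | rfl | rfl <;>
        simp [hbd, hcd, hba, hca, hda, nonOpp_refl, h, nonOpp_symm h]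
  · -- |l| ≥ 5 contradicts |A| ≤ 4
    simp only [List.length_cons] at hlen
    omega

/-- Former STUB, now CLOSED in the kernel by `coveringLemma_holds` (pen proof `PHASE-TORUS-LAW-g5.md` §2 (C);
typed by s4-prove-1 g32, 2026-08-29). Name kept so that downstream references are unchanged. -/
theorem stub_coveringLemma : CoveringLemma := coveringLemma_holds

/-! ### Typing target (director-hodge R19.132): `PhaseTorusLaw` — CLOSED in the sequel `PhaseTorusLawProof.lean` (PART C character
calculus below; PARTS A·B·D box covering, value-table bumps, product certificate ⇒ `phaseTorusLaw_holds` there). -/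

/-- The kernel-orientation half is pure bookkeeping: a non-negative weight with zero total is zero.
(`W ≥ 0`, `Σ W = Σ ν V = 0` by the `IIII` row of (M).) -/
theorem down_orientation_dead {ι : Type*} (s : Finset ι) (W : ι → ℝ) (hW : ∀ y ∈ s, 0 ≤ W y)
    (hsum : ∑ y ∈ s, W y = 0) : ∀ y ∈ s, W y = 0 :=
  (Finset.sum_eq_zero_iff_of_nonneg hW).1 hsum

/-! ## PART C — character calculus on `(ℤ/4)⁴` (SPEC by control g5; signatures FIXED; bodies = hands, keyed hodge-lit-semireg-typer-2 g11 / any idle hand — say which on the bus) -/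

/-! #### PART C helpers (s4-prove-1 g32): `e s = i^s` on `ℤ/4`, its additivity, conjugation, values -/

/-- `e s = i ^ s` for `s ∈ ℤ/4` (well defined since `i⁴ = 1`); `chi k τ = e (∑ f, k f * τ f)` by `rfl`. -/
noncomputable def e (s : ZMod 4) : ℂ := Complex.I ^ s.val

/-- `e 0 = 1`. -/
theorem e_zero : e 0 = 1 := by simp [e]

/-- `i ^ (4q + r) = i ^ r`. -/
theorem I_pow_four_mul_add (q r : ℕ) : Complex.I ^ (4 * q + r) = Complex.I ^ r := by
  rw [pow_add, pow_mul, Complex.I_pow_four, one_pow, one_mul]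

/-- `e (x + y) = e x * e y`. -/
theorem e_add (x y : ZMod 4) : e (x + y) = e x * e y := by
  unfold e
  rw [← pow_add]
  have h : (x + y).val = (x.val + y.val) % 4 := ZMod.val_add x y
  rw [h]
  conv_rhs => rw [← Nat.div_add_mod (x.val + y.val) 4]
  rw [I_pow_four_mul_add]

/-- `‖e x‖ = 1`. -/
theorem norm_e (x : ZMod 4) : ‖e x‖ = 1 := by
  simp [e, Complex.norm_I]

/-- `e x ≠ 0`. -/
theorem e_ne_zero (x : ZMod 4) : e x ≠ 0 := fun h => by
  have := norm_e x
  rw [h, norm_zero] at this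
  exact zero_ne_one this

/-- `e (-x) = conj (e x)` (`|e x| = 1`). -/
theorem e_neg (x : ZMod 4) : e (-x) = (starRingEnd ℂ) (e x) := by
  have h1 : e (-x) * e x = 1 := by rw [← e_add, neg_add_cancel, e_zero]
  have h2 : (starRingEnd ℂ) (e x) * e x = 1 := by
    rw [mul_comm, Complex.mul_conj, Complex.normSq_eq_norm_sq, norm_e]; norm_num
  exact mul_right_cancel₀ (e_ne_zero x) (h1.trans h2.symm)

/-- `e (∑ f, s f) = ∏ f, e (s f)` over `Fin 4`. -/
theorem e_sum (s : Fin 4 → ZMod 4) : e (∑ f, s f) = ∏ f, e (s f) := by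
  rw [Fin.sum_univ_four, Fin.prod_univ_four, e_add, e_add, e_add]

/-- `3 = -1` in `ℤ/4`. -/
theorem three_eq_neg_one : (3 : ZMod 4) = -1 := by decide

/-- A sum over `ℤ/4` written out. -/
theorem sum_univ_zmod4 {M : Type*} [AddCommMonoid M] (g : ZMod 4 → M) : ∑ j, g j = g 0 + g 1 + g 2 + g 3 := by
  have h : (Finset.univ : Finset (ZMod 4)) = {0, 1, 2, 3} := by decide
  rw [h, Finset.sum_insert (by decide), Finset.sum_insert (by decide), Finset.sum_insert (by decide),
    Finset.sum_singleton, add_assoc, add_assoc]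

/-- `e 1 = i`. -/
theorem e_one : e 1 = Complex.I := by
  rw [e, show (1 : ZMod 4).val = 1 from by decide, pow_one]

/-- `e 2 = -1`. -/
theorem e_two : e 2 = -1 := by
  rw [e, show (2 : ZMod 4).val = 2 from by decide, Complex.I_sq]

/-- `e 3 = -i`. -/
theorem e_three : e 3 = -Complex.I := by
  rw [three_eq_neg_one, e_neg, e_one, Complex.conj_I]

/-- The four values of `e`. -/
theorem e_cases (x : ZMod 4) : e x = 1 ∨ e x = Complex.I ∨ e x = -1 ∨ e x = -Complex.I := by
  have h4 : ∀ y : ZMod 4, y = 0 ∨ y = 1 ∨ y = 2 ∨ y = 3 := by decide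
  rcases h4 x with rfl | rfl | rfl | rfl
  · exact Or.inl e_zero
  · exact Or.inr (Or.inl e_one)
  · exact Or.inr (Or.inr (Or.inl e_two))
  · exact Or.inr (Or.inr (Or.inr e_three))

/-- `e (3x) = conj (e x)`. -/
theorem e_three_mul (x : ZMod 4) : e (3 * x) = (starRingEnd ℂ) (e x) := by
  rw [three_eq_neg_one, neg_one_mul, e_neg]

/-- `chi k τ = ∏ f, e (k f * τ f)` (the `e`-form of `chi_eq_prod`). -/
theorem chi_eq_prod_e (k τ : PT) : chi k τ = ∏ f, e (k f * τ f) := by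
  rw [chi, ← e_sum]; rfl

/-- Value at `x` of the coordinate-`f` trigonometric polynomial with coefficient table `c f`. -/
noncomputable def trig (c : Fin 4 → ZMod 4 → ℂ) (f : Fin 4) (x : ZMod 4) : ℂ := ∑ j, c f j * e (j * x)

/-- The product function `F(τ) = ∏_f φ_f(τ_f)` of four trigonometric polynomials. -/
noncomputable def prodF (c : Fin 4 → ZMod 4 → ℂ) (τ : PT) : ℂ := ∏ f, trig c f (τ f)

/-- Fourier expansion of the product: `F(τ) = ∑_k (∏_f c_f(k_f)) χ_k(τ)` (`Finset.prod_univ_sum`). -/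
theorem prodF_eq_sum (c : Fin 4 → ZMod 4 → ℂ) (τ : PT) :
    prodF c τ = ∑ k : PT, (∏ f, c f (k f)) * chi k τ := by
  unfold prodF trig
  rw [Finset.prod_univ_sum]
  simp only [Fintype.piFinset_univ]
  refine Finset.sum_congr rfl fun k _ => ?_
  rw [Finset.prod_mul_distrib, chi_eq_prod_e]

/-- Pairing with `ω`: `∑_τ ω(τ) F(τ) = ∑_k (∏_f c_f(k_f)) · moment ω k`. -/
theorem pairing_eq (c : Fin 4 → ZMod 4 → ℂ) (ω : PT → ℝ) :
    ∑ τ, (ω τ : ℂ) * prodF c τ = ∑ k : PT, (∏ f, c f (k f)) * moment ω k := by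
  simp only [prodF_eq_sum, moment, Finset.mul_sum]
  rw [Finset.sum_comm]
  refine Finset.sum_congr rfl fun k _ => Finset.sum_congr rfl fun τ _ => ?_
  ring



/- `I ^ n` only depends on `n mod 4` — spec item `I_pow_mod_four` of the crux workfile; it is ALREADY the tree's
`Literature.Computability.QuantumComplexity.BGK.I_pow_mod_four` (gate `dedup.landed`), so it is not re-declared here
(unused below; kept as an `example` for the record). -/
example (n : ℕ) : Complex.I ^ (n % 4) = Complex.I ^ n := by
  conv_rhs => rw [← Nat.div_add_mod n 4]
  exact (I_pow_four_mul_add _ _).symm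

/-- additivity of the exponent through `ZMod.val` (uses `I ^ 4 = 1`). -/
theorem I_pow_val_add (x y : ZMod 4) :
    Complex.I ^ (x + y).val = Complex.I ^ x.val * Complex.I ^ y.val := by
  exact e_add x y

/-- a character is the product of its one-coordinate factors. -/
theorem chi_eq_prod (k τ : PT) : chi k τ = ∏ f, Complex.I ^ ((k f * τ f).val) := by
  exact chi_eq_prod_e k τ

/-- `χ_{−k} = conj χ_k`. -/
theorem chi_neg_eq_conj (k τ : PT) : chi (-k) τ = (starRingEnd ℂ) (chi k τ) := by
  change e _ = (starRingEnd ℂ) (e _)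
  rw [← e_neg]
  congr 1
  simp only [Pi.neg_apply, neg_mul, Finset.sum_neg_distrib]

/-- real measures have conjugate-symmetric moments: `ω̂(−k) = conj ω̂(k)`. -/
theorem moment_neg_eq_conj (ω : PT → ℝ) (k : PT) :
    moment ω (-k) = (starRingEnd ℂ) (moment ω k) := by
  unfold moment
  rw [map_sum]
  refine Finset.sum_congr rfl fun τ _ => ?_
  rw [map_mul, Complex.conj_ofReal, chi_neg_eq_conj]

/-- in particular `moment ω (3,3,3,3) = conj (moment ω (1,1,1,1))` (`μ̄`). -/
theorem moment_three_eq_conj_moment_one (ω : PT → ℝ) :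
    moment ω (fun _ => 3) = (starRingEnd ℂ) (moment ω (fun _ => 1)) := by
  rw [show (fun _ => (3 : ZMod 4) : PT) = -(fun _ => 1) from funext fun _ => by rw [Pi.neg_apply]; decide]
  exact moment_neg_eq_conj ω _

/-- **Pairing expansion**: pairing `ω` against a product of one-coordinate trigonometric polynomials
`Σ_j b_f(j) I^{j t}` is the corresponding combination of moments (`Finset.prod_univ_sum` + `chi_eq_prod`). -/
theorem pairing_expansion (ω : PT → ℝ) (b : Fin 4 → ZMod 4 → ℂ) :
    ∑ τ : PT, (ω τ : ℂ) * ∏ f, (∑ j : ZMod 4, b f j * Complex.I ^ ((j * τ f).val)) =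
      ∑ k : PT, (∏ f, b f (k f)) * moment ω k := by
  exact pairing_eq b ω

end Summit.Ventures.HSemireg.PhaseTorus
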